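import Summits.BirchSwinnertonDyer.BirchSwinnertonDyer.Theorems.AdditiveBranchIMCGordTwoTwistedFrame
import Summits.BirchSwinnertonDyer.BirchSwinnertonDyer.Theorems.AdditiveBranchIMCTwistAtTwoSplitFlip
import HarnessLib

/-!
# The DYADIC genus class of the twisted Wan road: `2` as the twisted Wan prime — `E^{(d_K)}` at `2` and `E/K_λ` for `2 ∣ d_K`
# (crux 19357 `GordTwoRankZeroOffCaseOne`, line `three_field_road`; groundwork for the brick «`ℓ₀ = 2`» of LeadReport26 §4.1;
# LEAD cruxlead-19357 g17; `--supports` 19357, helper only)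

Theorems only (no definition, no named fact, no `sorry`); nothing about BSD is asserted. The odd-prime clauses of the twisted road
(`TwistRootNumberTwisted.quadraticTwist_discr_nonsplit_at_of_nonsplitClass`, `TwistedWanRoad.baseChange_nonsplit_of_nonsplitClass`,
p797470 / p805277: for an odd twisted Wan prime `ℓ₀ ∣ d_K` in the non-split GENUS class — the Legendre symbol `(d_K/ℓ₀*/ℓ₀)` — a
globally minimal `Wd ≅ E^{(d_K)}` is multiplicative NON-split at `ℓ₀`, hence `E/K_λ` is at the ramified `λ ∣ ℓ₀`) have a DYADIC sibling
(pen e19 memo §6 addendum, the class table in `ℚ₂^×/ℚ₂^{×2}`), which this file proves from the tree's unramified 2-adic twist law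
(`hasSplitMultiplicativeReductionAtPrime_two_quadraticTwist_iff_of_emod_four`, p812548):

Let `E` (any model `W`) be additive at `2` and POTENTIALLY MULTIPLICATIVE of twist type there: `W₁ := E^{(t)}` is multiplicative at `2` for
one `t ∈ {−1, 2, −2}`. Let `K` be imaginary quadratic with `2 ∣ d_K`, written `d_K = 4·t·n` with `n ≡ 1 (mod 4)` (every even fundamental
discriminant has exactly one such shape for the given `t`: `−4n` for `t = −1`, `±8|n|` for `t = ±2`). Then `E^{(d_K)} ≅ E^{(t n)} = W₁^{(n)}` over
`ℚ` (the factor `4` is a square), an UNRAMIFIED twist of the multiplicative `W₁` at `2`: multiplicative, split iff (`n ≡ 1 (8)` ↔ `W₁` split).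
THE DYADIC NON-SPLIT CLASS is therefore `n ≡ 1 (mod 8)` if `W₁` is non-split at `2` and `n ≡ 5 (mod 8)` if `W₁` is split — ONE class of `d_K`
in `ℚ₂^×/ℚ₂^{×2}` (`d_K ~ t` resp. `d_K ~ 5t`), as in the pen's table.

* `quadraticTwist_discr_nonsplit_at_two_of_dyadicClass` — in that class a globally minimal `Wd ≅ E^{(d_K)}` is multiplicative NON-split at `2`;
* `baseChange_nonsplit_two_of_dyadicClass` — hence `E/K` is multiplicative NON-split at the (ramified, degree-one) prime `λ ∣ 2` of `K`
  (`Wd ≅ E` over `K = ℚ(√d_K)`; the base-change half of p805277 is prime-generic).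

This is clause (S4‴) at `ℓ₀ = 2`, the input «`E/K` non-split multiplicative above `2`» of the (not yet typed) dyadic readings R2₂/R3₂/R4₂.
References: [SilvermanAEC2009] VII.5 Prop. 5.1 (b), Prop. 5.4 (b), X.5 Cor. 5.4, App. A Prop. A.1.1; [Cox2013] §2 (even discriminants).
presearch: n/a (tree lemma). BSD is proved for no curve.
-/

set_option linter.dupNamespace false
set_option autoImplicit false

noncomputable section

open scoped Classical

open NumberField IsDedekindDomain IsDedekindDomain.HeightOneSpectrum Rat.HeightOneSpectrum Field
open WeierstrassCurve Literature.NumberTheory.EllipticCurves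
open Summit.BirchSwinnertonDyer.Rank1Residual Summit.BirchSwinnertonDyer.Rank1Residual.Additive
open Summit.BirchSwinnertonDyer.BirchSwinnertonDyer.Theorems

namespace Summit.BirchSwinnertonDyer.BirchSwinnertonDyer.Theorems.TwistedWanRoad

variable (W : WeierstrassCurve ℚ) [W.IsElliptic]

/-- **The dyadic non-split class, over `ℚ`.** `E` (any model `W`) with `W₁ = E^{(t)}` multiplicative at `2` (`t ∈ {−1, 2, −2}`), `K` a number field
with `d_K = 4·t·n`, `n ≡ 1 (mod 8)` if `W₁` is non-split at `2` and `n ≡ 5 (mod 8)` if it is split: every globally minimal `Wd ≅ E^{(d_K)}` is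
multiplicative NON-split at `2` (`E^{(d_K)} ≅ W₁^{(n)}`, an unramified twist at `2`; p812548). [cite: SilvermanAEC2009, X.5 Cor. 5.4 and App. A Prop. A.1.1] -/
theorem quadraticTwist_discr_nonsplit_at_two_of_dyadicClass {t : ℤ} (ht : t = -1 ∨ t = 2 ∨ t = -2)
    (hmult : (W.quadraticTwist (t : ℚ)).HasMultiplicativeReductionAtPrime 2)
    (K : Type) [Field K] [NumberField K] {n : ℤ} (hn : NumberField.discr K = 4 * t * n)
    (hclass : n % 8 = if (W.quadraticTwist (t : ℚ)).HasSplitMultiplicativeReductionAtPrime 2 then 5 else 1)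
    (Wd : WeierstrassCurve ℚ) [Wd.IsElliptic]
    (hWd : ∃ C : VariableChange ℚ, C • W.quadraticTwist (NumberField.discr K : ℚ) = Wd) :
    Wd.HasMultiplicativeReductionAtPrime 2 ∧ ¬ Wd.HasSplitMultiplicativeReductionAtPrime 2 := by
  have ht0 : (t : ℚ) ≠ 0 := by rcases ht with rfl | rfl | rfl <;> norm_num
  have hn4 : n % 4 = 1 := by split_ifs at hclass <;> omega
  have hn0 : (n : ℚ) ≠ 0 := by
    have : n ≠ 0 := by rintro rfl; simp at hn4
    exact_mod_cast this
  set W₁ := W.quadraticTwist (t : ℚ) with hW₁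
  haveI : W₁.IsElliptic := W.isElliptic_quadraticTwist ht0
  haveI : (W₁.quadraticTwist (n : ℚ)).IsElliptic := W₁.isElliptic_quadraticTwist hn0
  -- `E^{(d_K)} = (W₁^{(n)})^{(2²)} = C₂ • W₁^{(n)}`
  obtain ⟨C₂, hC₂⟩ := (W₁.quadraticTwist (n : ℚ)).exists_variableChange_smul_eq_quadraticTwist_sq (θ := (2 : ℚ)) two_ne_zero
  have hdK : W.quadraticTwist (NumberField.discr K : ℚ) = C₂ • W₁.quadraticTwist (n : ℚ) := by
    rw [hC₂, hW₁, quadraticTwist_quadraticTwist, quadraticTwist_quadraticTwist, hn]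
    push_cast; ring_nf
  obtain ⟨C, hC⟩ := hWd
  have hWd' : Wd = (C * C₂) • W₁.quadraticTwist (n : ℚ) := by rw [mul_smul, ← hdK, hC]
  -- the unramified 2-adic twist of the multiplicative `W₁`
  obtain ⟨hm, hs⟩ := TwistRootNumberTwisted.hasMultiplicativeReductionAtPrime_two_quadraticTwist_and_split_iff_of_emod_four W₁ hn4 hmult
  refine ⟨by rw [hWd', hasMultiplicativeReductionAtPrime_smul_iff]; exact hm, fun h ↦ ?_⟩
  rw [hWd', hasSplitMultiplicativeReductionAtPrime_smul_iff, hs] at h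
  by_cases hsp : W₁.HasSplitMultiplicativeReductionAtPrime 2
  · rw [if_pos hsp] at hclass
    have := h.mpr hsp; omega
  · rw [if_neg hsp] at hclass
    exact hsp (h.mp hclass)

/-- **The dyadic non-split class, over the road field.** `E/ℚ` globally minimal with `W₁ = E^{(t)}` multiplicative at `2`, `K` imaginary quadratic with
`d_K = 4·t·n` in the dyadic non-split class: `E/K` is multiplicative NON-split at every prime `λ` of `K` above `2` (`λ² = (2)`, residue field `𝔽₂`;
`Wd ≅ E` over `K`). The `ℓ₀ = 2` sibling of `baseChange_nonsplit_of_nonsplitClass` (p805277). [cite: SilvermanAEC2009, VII.5 Prop. 5.1 (b), Prop. 5.4 (b), X.5 Cor. 5.4] -/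
theorem baseChange_nonsplit_two_of_dyadicClass [W.IsGloballyMinimal] {t : ℤ} (ht : t = -1 ∨ t = 2 ∨ t = -2)
    (hmult : (W.quadraticTwist (t : ℚ)).HasMultiplicativeReductionAtPrime 2)
    (K : Type) [Field K] [NumberField K] (hK : IsImaginaryQuadratic K) {n : ℤ} (hn : NumberField.discr K = 4 * t * n)
    (hclass : n % 8 = if (W.quadraticTwist (t : ℚ)).HasSplitMultiplicativeReductionAtPrime 2 then 5 else 1) :
    ∀ v : HeightOneSpectrum (𝓞 K), ((2 : ℕ) : 𝓞 K) ∈ v.asIdeal →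
      (W.baseChange K).HasMultiplicativeReductionAt v ∧ ¬ (W.baseChange K).HasSplitMultiplicativeReductionAt v := by
  intro v hv
  haveI : Fact (Nat.Prime 2) := ⟨Nat.prime_two⟩
  haveI : (W.baseChange K).IsElliptic := by rw [baseChange]; infer_instance
  -- a globally minimal model `Wd` of `E^{(d_K)}`; it is multiplicative NON-split at `2` over `ℚ`
  have hD0 : (NumberField.discr K : ℚ) ≠ 0 := by exact_mod_cast NumberField.discr_ne_zero K
  haveI : (W.quadraticTwist (NumberField.discr K : ℚ)).IsElliptic := W.isElliptic_quadraticTwist hD0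
  obtain ⟨Cd, hCd⟩ := hasGlobalMinimalModel_rat_holds (W.quadraticTwist (NumberField.discr K : ℚ))
  haveI : (Cd • W.quadraticTwist (NumberField.discr K : ℚ)).IsGloballyMinimal := hCd
  set Wd := Cd • W.quadraticTwist (NumberField.discr K : ℚ) with hWd
  haveI : (Wd.baseChange K).IsElliptic := by rw [baseChange]; infer_instance
  obtain ⟨hmd, hnsd⟩ := quadraticTwist_discr_nonsplit_at_two_of_dyadicClass W ht hmult K hn hclass Wd ⟨Cd, rfl⟩
  -- `2 ∣ d_K`
  have h2K : (2 : ℤ) ∣ NumberField.discr K := ⟨2 * t * n, by rw [hn]; ring⟩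
  -- over `K = ℚ(√d_K)`: `Wd ⊗ K = C′ • (E ⊗ K)`
  obtain ⟨C', hC'⟩ := GenusKolyvagin.exists_variableChange_baseChange_of_quadraticTwist_discr hK.1 W Wd ⟨Cd, rfl⟩
  have hmv : (Wd.baseChange K).HasMultiplicativeReductionAt v :=
    (isMinimalAt_and_hasMultiplicativeReductionAt_baseChange_of_mult Wd (p := 2) hmd v hv).2
  have hN : Ideal.absNorm v.asIdeal = 2 :=
    GenusKolyvagin.absNorm_eq_of_ncard_eq_two_or_dvd_discr hK.1 Nat.prime_two v hv (Or.inr h2K)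
  have hnsv : ¬ (Wd.baseChange K).HasSplitMultiplicativeReductionAt v :=
    not_hasSplitMultiplicativeReductionAt_baseChange_of_not_split_prime Wd 2 v hv hN hmd hnsd
  rw [← hC'] at hmv hnsv
  exact ⟨(WeierstrassCurve.hasMultiplicativeReductionAt_smul_iff_holds v (W.baseChange K) C').mp hmv,
    fun h ↦ hnsv ((WeierstrassCurve.hasSplitMultiplicativeReductionAt_smul_iff_holds v (W.baseChange K) C').mpr h)⟩

end Summit.BirchSwinnertonDyer.BirchSwinnertonDyer.Theorems.TwistedWanRoad

end
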